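import Summits.BirchSwinnertonDyer.BirchSwinnertonDyer.Theorems.EisensteinPrimesBSDpOnCellCOfNamedFactsV17P
import Summits.BirchSwinnertonDyer.BirchSwinnertonDyer.Theorems.EisensteinPrimesBSDpOnCellCTelescopeCarrierSplit
import Summits.BirchSwinnertonDyer.BirchSwinnertonDyer.Theorems.EisensteinPrimesBSDpOnCellCTelescopeCarrierAlgOfWitness
import Summits.BirchSwinnertonDyer.BirchSwinnertonDyer.Theorems.SignedBaseChangeAnticyclotomicEisensteinDivisibilitySpecializationHerbrand
import Summits.BirchSwinnertonDyer.Rank1Residual.X11b.BDPRouteOpenInputDegenerateFrame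
import Literature.NumberTheory.EllipticCurves.IwasawaAlgebraRankOneIdealProofs
import Literature.NumberTheory.EllipticCurves.IwasawaSelmerIsTorsionProofs
import Literature.NumberTheory.IwasawaTheory.IwasawaAlgebraTwoVarRegularProofs
import HarnessLib

/-!
# The member-torsion clause of Keller–Yin 2024 Thm. 3.0.8 discharges the per-member residue of leaf N3 — line «telescope», crux 4
# `BSDpOnCellC` (item stmt-BirchSwinnertonDyer-19034) — ideator bsd-idea-12 g35, crux idea «k2-classical» rev 2.1 (workfile `telescopeK2reg`, v1.0)

UNREGISTERED workfile (W-79: publish-only; the registered skeleton of record stays telescope v4 `645c0fbc…`; the LEAD's v6 is announced and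
unregistered). Nothing here is a stub of the registered skeleton; nothing here proves a crux, a registered stub, or any summit statement.
BSD is proved for no curve.

## What this file does
Leaf N3 `K2Leaves.stub_memberControl` (tree `Lines/telescopeK2leaves.lean` v1.0, l.292–400) asserts, for every branch lattice `ρ₂` with the
typed fibre data FD and (fg): `∀ k`, (reg_k) «the member fibre `X₂/π_k X₂` (`π_k = C (X − C x_k)`) is killed by some `s ∈ B = ℤ_p⟦X⟧⟦T⟧` with
`π_k ∤ s`» and (ctrl_k). Its docstring (g34 FINDING) isolated the only per-member ARITHMETIC input: `Λ`-torsion of the member's big dual Selmer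
module `𝔛(g_k) = XBig κ (A_{g_k}†) 𝔭bar ∅` at the finitely many `k` with `π_k ∣ char_B X₂`, and called it "not in print", proposing the RESHAPE
`∀ k ↦ ∃ k₀ ∀ k ≥ k₀` upstream. THIS FILE WITHDRAWS THAT: the torsion of `𝔛(g_k)` IS CLAUSE (1) OF THE SAME PREPRINT THEOREM the line already
cites for (div_k) — Keller–Yin, arXiv:2402.12781v2, Thm. 3.0.8 (IMC2) [v1: Thm. 3.0.11], VERBATIM (held text of v1, p. 21 L35–L38 = v2 p. 40): «Both
`H¹_{F_Gr}(K,𝕋)` and `𝔛_f = H¹_{F_Gr}(K,M_f)^∨` are Λ-torsion, and the equality `ξ_Λ(𝔛_f)Λ^{ur} = (𝓛_f)` holds», applied by KY in §5.1 (a)–(d)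
to exactly these crystalline members; Rem. 3.0.9 removes `H⁰(K, ρ̄_f) = 0`. The tree's typed form `KellerYin2024.thm308_imc2_hidaMember_dvd_OPEN`
(typer T2, p721227) records only the one-sided ideal membership (IMC2'), whose `Module.charIdeal` is junk `⊤` off the torsion locus
(`charIdeal_eq_top_of_not_isTorsion`), i.e. it silently dropped the torsion clause. So the residue of N3 is a MISSING TYPED CLAUSE of an
already-cited preprint theorem, not an unprinted input, and no reshape of K2-D♭ / K2-M♭ / N3 is needed.

* **`stub_memberTorsionKY`** [PURE CITE, preprint-shaped]: binders = those of `thm308_imc2_hidaMember_dvd_OPEN` TOKEN FOR TOKEN (member `D`,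
  `ι' ∘ D.ι = id`, parity `2(p−1) ∣ k−2`, reading map `b`, a weight-`k` BDP frame, the two instance binders), conclusion
  `Module.IsTorsion (PowerSeries 𝒪_k) (XBig κ (D.Δ.selfDualCofreeRepOver K) 𝔭bar ∅)`. TYPING WANT (INPUTS desk): add
  `thm308_imc2_hidaMember_isTorsion_OPEN : Prop := <this statement>` next to the (IMC2') def; the stub then closes `fun h => h`.
* **`stub_memberControlMod`** (N3′) [CONTENT — bench leaf L, INPUT-FREE beyond FD + (fg)]: N3 with (reg_k) replaced by the TORSION TRANSFER
  «(`𝔛(g_k)` is `Λ_{𝒪_k}`-torsion for every admissible topology) → ∃ `t ∈ Λ = ℤ_p⟦T⟧`, `t ≠ 0`, `t · (X₂/π_k X₂) = 0`»; (ctrl_k) verbatim.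
  Proof plan (control theorems only): exact `π_k`-control `X₂/π_k X₂ ≅ (Sel(A₂)[π_k])^∨` (`TelescopeK2WeightControl.quotXBig_equiv_dual_selmer_torsion`,
  p737740, with `r := π_k`), the control map `Sel(A₂[π_k]) → Sel(A₂)[π_k]` with finite kernel and cotorsion cokernel
  (`twoSided_finite_control`, `finite_ker_torsionInclH1_of_finite_quot`), transport along the quasi-isomorphism `θ_k` of (fd_k), and (rat_k)
  `ℤ_p ↠ 𝒪_k` to read `Λ_{𝒪_k}`-torsion as `Λ`-torsion; a finitely generated torsion module over the domain `Λ` has a non-zero annihilator.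
* **`exists_not_dvd_forall_smul_eq_zero`** (ALG1, PROVED): for a retraction `φ : B → Λ` of `Λ → B` with `φ π = 0` and a finite `B`-module `M`,
  a non-zero `t ∈ Λ` killing `M/πM` yields `s ∈ B` with `π ∤ s`, `sM = 0` — Cayley–Hamilton (Matsumura 2.1, Mathlib
  `LinearMap.exists_monic_and_natDegree_eq_and_coeff_mem_pow_and_aeval_eq_zero`) for the homothety `t` with `tM ⊆ πM`: `s := q(t)`,
  `φ s = t^{deg q} ≠ 0`. **`exists_ne_zero_forall_smul_quot_eq_zero`** (ALG2, PROVED): the converse when `ker φ ⊆ (π)`.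
* **kernel `memberControl_of_mod : N3′ → stub_memberTorsionKY → N3`** — SORRY-FREE; conclusion = the statement of `K2Leaves.stub_memberControl`
  TOKEN FOR TOKEN (text copied from tree `Lines/telescopeK2leaves.lean` l.310–399, not importable here); per `k`: `CellC` unfolds to `2 < p`,
  `Red`, multiplicative (`MemberInvariantsOfAnacongWt.*_of_cellC`), the reading map `b` from `exists_ringHom_padicCoeffIntegers_padicComplexInt`,
  the frame from the member package, then ALG1 with `φ_k = PowerSeries.map (evAt x_k)` (`TelescopeCarrierAlgOfWitness.evAtMap_map_C`, `evAtMap_pi`).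
* **converse `memberControlMod_of_memberControl : N3 → N3′`** — SORRY-FREE (ALG2 + `C_dvd_of_evAtMap_eq_zero`): the reshaped leaf loses nothing.

Net effect on the k2-classical leaf map: N1 (construction/typist) · N2 (bench XL) · N3′ (bench L, input-free) · one more clause of the KY24
preprint theorem already cited by K1 (pure cite). `lean check`: rc 0, sorries = 2 (exactly `stub_memberTorsionKY`, `stub_memberControlMod`);
ALG1, ALG2, kernel and converse sorry-free.
[claim: KellerYin2024, status: under-review] [cite: KellerYin2024, Thm. 3.0.8 (IMC2) clause 1, Rem. 3.0.9, §5.1 (a)–(d) (arXiv:2402.12781v2 pp. 40, 43; v1 Thm. 3.0.11 p. 21)]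
[cite: Matsumura1986, Thm. 2.1] [cite: SkinnerUrban2014, §3.1.6, Cor. 3.2.9] [cite: Ochiai2006, Prop. 5.1] [cite: Greenberg2016, Prop. 4.1.1]
[cite: BourbakiAC5to7, VII §4.5 Prop. 10]
-/

set_option autoImplicit false
set_option linter.dupNamespace false

noncomputable section

open scoped Classical MatrixGroups ModularForm

open CongruenceSubgroup WeierstrassCurve NumberField IsDedekindDomain Field PowerSeries
  Literature.NumberTheory.EllipticCurves Literature.NumberTheory.EllipticCurves.GreenbergSelmer
  Literature.NumberTheory.EllipticCurves.ModularForms Literature.NumberTheory.QuadraticFields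
  Literature.NumberTheory.EllipticCurves.Rank1Residual
  Literature.NumberTheory.EllipticCurves.Rank1Residual.Typed
  Literature.NumberTheory.EllipticCurves.KrizLi2019
  Literature.NumberTheory.EllipticCurves.GreenbergVatsal2000
  Literature.NumberTheory.EllipticCurves.Wuthrich2014
  Literature.NumberTheory.EllipticCurves.SteinWuthrich2013
  Literature.NumberTheory.EllipticCurves.Castella2018Exceptional
  Literature.NumberTheory.GaloisRepresentations Literature.NumberTheory.GaloisCohomology
  Literature.NumberTheory.Automorphic
  Summit.BirchSwinnertonDyer.Rank1Residual.X11b.AcSelmer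
  Summit.BirchSwinnertonDyer.Rank1Residual.X11b.Halves
  Summit.BirchSwinnertonDyer.Rank1Residual.X11b
  Summit.BirchSwinnertonDyer.Rank1Residual Summit.BirchSwinnertonDyer.Rank1Residual.X1
  Summit.BirchSwinnertonDyer.Rank1Residual.X2
open Literature.NumberTheory.EllipticCurves.KellerYin2024 (curveLocalLambda)

open Literature.NumberTheory.EllipticCurves.BigGaloisRep

namespace Summit.BirchSwinnertonDyer.BirchSwinnertonDyer.Cruxes.BSDpOnCellC.Telescope.K2Reg


open Literature.NumberTheory.EllipticCurves.CastellaGrossiLeeSkinner2022 Literature.NumberTheory.EllipticCurves.Castella2018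
  Literature.NumberTheory.IwasawaTheory Literature.NumberTheory.IwasawaTheory.Greenberg2016
  Literature.NumberTheory.IwasawaTheory.Greenberg2006
  Summit.BirchSwinnertonDyer.Rank1Residual.X1.KellerYinMuLambdaSplit
open Literature.NumberTheory.EllipticCurves.KellerYin2024
open Summit.BirchSwinnertonDyer.BirchSwinnertonDyer.Theorems

/-! ## §R1 The torsion clause of Keller–Yin 2024 Thm. 3.0.8 (IMC2) for a Hida member (pure cite, preprint-shaped) -/

set_option maxHeartbeats 800000 in
/-- **stub_memberTorsionKY** [PURE CITE — unrefereed preprint, shape only]. Clause (1) of Keller–Yin, arXiv:2402.12781v2, Thm. 3.0.8 (IMC2)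
«`𝔛_f = H¹_{F_Gr}(K, M_f)^∨` is `Λ`-torsion» for `f :=` the crystalline Hida member `D.g` of `E/ℚ` at an odd multiplicative Eisenstein prime
`p ∥ N`, on the self-dual Tate twist, exactly as KY apply it in §5.1 (a)–(d); binders = those of the tree's
`KellerYin2024.thm308_imc2_hidaMember_dvd_OPEN` TOKEN FOR TOKEN (same dictionary, same flags `KY-Gr`, `KY-lattice`, `KY-frame-∀`; the frame and
the reading map `b` are irrelevant to the conclusion and only kept so that the statement is the (IMC2') typing with its last three lines
replaced). Missing typed clause, not a new input: TYPING WANT `thm308_imc2_hidaMember_isTorsion_OPEN`. Size: 0 (closes `fun h => h` once typed).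
Why it might fail: only with the preprint (a member `g_k` whose anticyclotomic Greenberg Selmer group over `K_∞` has positive `Λ`-corank would
contradict KY Thm. 3.0.8 itself). [claim: KellerYin2024, status: under-review]
[cite: KellerYin2024, Thm. 3.0.8 (IMC2) clause 1, Rem. 3.0.9, Thm. 3.0.5 (Koly)/(tor), §5.1 (a)–(d) (arXiv:2402.12781v2 pp. 38–40, 43)] -/
theorem stub_memberTorsionKY :
    ∀ (W : WeierstrassCurve ℚ) [W.IsElliptic] [W.IsGloballyMinimal] (p : ℕ) [Fact p.Prime],
    2 < p → Red W p → W.HasMultiplicativeReductionAtPrime p →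
    ∀ (N : ℕ) [NeZero N] (K : Type) [Field K] [NumberField K],
      W.conductorNorm ℤ = N →
      IsImaginaryQuadratic K → NumberField.discr K < -4 → SatisfiesHeegnerHypothesis N K →
      Odd (NumberField.discr K) →
      ∀ (κ : ZpExtension K p), κ.IsAnticyclotomic →
        ∀ (γ : Field.absoluteGaloisGroup K) [Fact (κ.IsTopGenerator γ)]
          (𝔭 : HeightOneSpectrum (𝓞 K)), ((p : ℕ) : 𝓞 K) ∈ 𝔭.asIdeal →
          𝔭.asIdeal.ramificationIdx (𝓞 ℚ) = 1 → 𝔭.asIdeal.inertiaDeg (𝓞 ℚ) = 1 →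
          ∀ (𝔭bar : HeightOneSpectrum (𝓞 K)), ((p : ℕ) : 𝓞 K) ∈ 𝔭bar.asIdeal → 𝔭bar ≠ 𝔭 →
            ((Ideal.span {(p : ℤ)}).primesOver (𝓞 K)).ncard = 2 →
          ∀ (ι' : PadicAlgCl p ≃+* ℂ),
            (∀ (w : InfinitePlace K) (k : 𝓞 K), k ∈ 𝔭.asIdeal ↔ ‖ι'.symm (w.embedding (k : K))‖ < 1) →
          ∀ (D : Skinner2016.HidaCongruentForm W p 1),
            (∀ y : coeffField D.g, ι' (D.ι y) = (y : ℂ)) → 2 * ((p : ℤ) - 1) ∣ D.k - 2 →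
            ∀ (b : padicCoeffIntegers D.ι →+* 𝓞_ℂ_[p]),
              (∀ y, ((b y : 𝓞_ℂ_[p]) : ℂ_[p]) =
                algebraMap (PadicAlgCl p) ℂ_[p] (padicCoeffIntegers.toPadicAlgCl D.ι y)) →
            ∀ (ΩKg : ℂ) (Ωpg : ℂ_[p]) (Lg : UnrSeries p), ΩKg ≠ 0 → ‖Ωpg‖ = 1 →
              IsBDPLFunctionWt ι' 𝔭 κ γ D.g ΩKg Ωpg Lg →
            ∀ [TopologicalSpace (PowerSeries (padicCoeffIntegers D.ι))]
              [ContinuousSMul (PowerSeries (padicCoeffIntegers D.ι))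
                (BigRepModule (padicCoeffIntegers D.ι) p (Cofree D.Δ.selfDualRep (padicCoeffField D.ι)))],
              Module.IsTorsion (PowerSeries (padicCoeffIntegers D.ι))
                (XBig κ (D.Δ.selfDualCofreeRepOver K) 𝔭bar (∅ : Set (HeightOneSpectrum (𝓞 K)))) := by
  sorry

/-! ## §R2 Member control leaf, input-free form (bench L) -/

set_option maxHeartbeats 1600000 in
/-- **stub_memberControlMod** (N3′) [CONTENT — bench leaf L, INPUT-FREE beyond the fibre data FD and (fg)]. The text of
`K2Leaves.stub_memberControl` (N3) with its prefix and (ctrl_k) TOKEN FOR TOKEN and (reg_k) replaced by the TORSION TRANSFER: if the member's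
big dual Selmer module `𝔛(g_k) = XBig κ (A_{g_k}†) 𝔭bar ∅` is `Λ_{𝒪_k}`-torsion (for every admissible topology on `Λ_{𝒪_k}`), then some non-zero
`t ∈ Λ = ℤ_p⟦T⟧` kills the member fibre `X₂/π_k X₂` (`π_k = C (X − C x_k)`; `Λ` acts through `PowerSeries.map C`, the binder's scalar tower).
Proof plan: exact `π_k`-control `quotXBig_equiv_dual_selmer_torsion` (p737740) + the control map `Sel(A₂[π_k]) → Sel(A₂)[π_k]` (finite kernel by
`finite_ker_torsionInclH1_of_finite_quot`; cokernel inside the local terms, cotorsion) + transport along `θ_k` ((fd_k), finite kernel/cokernel) +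
(rat_k) `ℤ_p ↠ 𝒪_k`; then a finitely generated torsion module over the domain `Λ` has a non-zero annihilator. (ctrl_k) as in N3 (both sides are
junk `⊤` simultaneously off the torsion locus, so no torsion input is needed there).
Why it might fail: the cokernel of the control map must be `Λ`-cotorsion; the local error terms at the finitely decomposed primes (those above
`p`, and `ℓ ∣ N` — split in `K` by (Heeg)) are subquotients of `A₂(K_{∞,w})/π_k`, cofinitely generated over `ℤ_p`, hence cotorsion; at an inert
`ℓ ∤ Np` (completely split in `K_∞^{ac}`, induced local terms) this needs `ρ₂` UNRAMIFIED at `ℓ`, while FD's (unr) only bounds the ramification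
by some finite `S₀` — for `ℓ ∈ S₀` inert the bench proof must first show inertia acts trivially on `A₂` (from (fd_k) at infinitely many `k`:
`(τ − 1)A₂[π_k]` finite for all `k` forces the inertia matrix `g(X) − 1` to vanish at every `x_k`, hence identically); a typing slip in FD
(wrong twist in (fd_k)) would also surface here first. N3′ is implied by N3 (`memberControlMod_of_memberControl` below), so it inherits no risk
that N3 (g34, under review) does not already carry.
Sources: [cite: SkinnerUrban2014, §3.1.6, Cor. 3.2.9] [cite: Ochiai2006, Prop. 5.1] [cite: Greenberg2016, Prop. 4.1.1] [cite: Greenberg2006, Prop. 3.6] -/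
theorem stub_memberControlMod :
    ∀ (W : WeierstrassCurve ℚ) [W.IsElliptic] [W.IsGloballyMinimal] (p : ℕ) [Fact p.Prime],
    ∀ (N : ℕ) [NeZero N] (K : Type) [Field K] [NumberField K] (Dt : ModularParametrizationData W N)
      (H : HeegnerDatum N (NumberField.discr K)) (ιK : K →+* ℂ) (P : (W.baseChange K).toAffine.Point),
      CellC W p → W.conductorNorm ℤ = N →
      IsImaginaryQuadratic K → NumberField.discr K < -4 → SatisfiesHeegnerHypothesis N K →
      (W.quadraticTwist (NumberField.discr K : ℚ)).entireLFunction 1 ≠ 0 →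
      WeierstrassCurve.Affine.Point.map ιK.toRatAlgHom P = heegnerPointComplex Dt H →
      ¬ (p : ℤ) ∣ Dt.c → ¬ IsOfFinAddOrder P →
      Odd (NumberField.discr K) →
      ∀ (κ : ZpExtension K p), κ.IsAnticyclotomic →
        ∀ (γ : Field.absoluteGaloisGroup K) [Fact (κ.IsTopGenerator γ)]
          (𝔭 : HeightOneSpectrum (𝓞 K)), ((p : ℕ) : 𝓞 K) ∈ 𝔭.asIdeal →
          𝔭.asIdeal.ramificationIdx (𝓞 ℚ) = 1 → 𝔭.asIdeal.inertiaDeg (𝓞 ℚ) = 1 →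
          ∀ (𝔭bar : HeightOneSpectrum (𝓞 K)), ((p : ℕ) : 𝓞 K) ∈ 𝔭bar.asIdeal → 𝔭bar ≠ 𝔭 →
            ((Ideal.span {(p : ℤ)}).primesOver (𝓞 K)).ncard = 2 →
          ∀ (f : CuspForm (CongruenceSubgroup.Gamma0 N) 2), IsNewformOf W f →
            ∀ (ι' : PadicAlgCl p ≃+* ℂ),
              (∀ (w : InfinitePlace K) (k : 𝓞 K),
                k ∈ 𝔭.asIdeal ↔ ‖ι'.symm (w.embedding (k : K))‖ < 1) →
              ∀ (ΩK : ℂ) (Ωp : ℂ_[p]) (Q : PowerSeries 𝓞_ℂ_[p]), ΩK ≠ 0 → ‖Ωp‖ = 1 →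
                R1.IsBDPLFunctionInt p ι' 𝔭 κ γ f ΩK Ωp Q →
      ∀ (L : PowerSeries (PowerSeries (unrIntegers p))) (x : ℕ → ℤ_[p]) (D : ℕ → Skinner2016.HidaCongruentForm W p 1),
        (∀ k, ‖x k‖ < 1) ∧ Filter.Tendsto x Filter.atTop (nhds 0) ∧
        (∃ e : ℕ, PowerSeries.C ((p : 𝓞_ℂ_[p]) ^ e) * Q ∈
          Ideal.span {PowerSeries.map (R1.unrToCpInt p) (PowerSeries.map (PowerSeries.constantCoeff (R := unrIntegers p)) L)}) ∧
        (∀ k : ℕ, (∀ y : coeffField (D k).g, ι' ((D k).ι y) = (y : ℂ)) ∧ 2 * ((p : ℤ) - 1) ∣ (D k).k - 2 ∧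
          ∃ (ΩKg : ℂ) (Ωpg : ℂ_[p]) (Lg : UnrSeries p), ΩKg ≠ 0 ∧ ‖Ωpg‖ = 1 ∧
            IsBDPLFunctionWt ι' 𝔭 κ γ (D k).g ΩKg Ωpg Lg ∧
          ∃ Ψ : UnrSeries p,
            (∃ U : PowerSeries (PowerSeries (unrIntegers p)),
              PowerSeries.map (PowerSeries.C (R := unrIntegers p)) Ψ =
                L + PowerSeries.C (PowerSeries.X - PowerSeries.C (toUnr p (x k))) * U) ∧
            (∃ e : ℕ, PowerSeries.C ((p : 𝓞_ℂ_[p]) ^ e) * PowerSeries.map (R1.unrToCpInt p) Ψ ∈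
              Ideal.span {PowerSeries.map (R1.unrToCpInt p) Lg})) ∧
        (∃ A : ℕ → UnrSeries p, ∀ ℓ : ℕ, ℓ.Prime → ¬ ℓ ∣ N →
          (∃ U : UnrSeries p, A ℓ = PowerSeries.C (toUnr p ((W.frobeniusTrace ℓ : ℤ) : ℤ_[p])) + PowerSeries.X * U) ∧
          ∀ k : ℕ, ∃ (c : unrIntegers p) (U : UnrSeries p),
            A ℓ = PowerSeries.C c + (PowerSeries.X - PowerSeries.C (toUnr p (x k))) * U ∧
            ((c : ℂ_[p]) = algebraMap (PadicAlgCl p) ℂ_[p]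
              ((D k).ι ⟨(UpperHalfPlane.qExpansion 1 ⇑(D k).g).coeff ℓ, coeff_mem_coeffField (D k).g ℓ⟩))) →
      ∀ [TopologicalSpace (PowerSeries ℤ_[p])] (A₂ : Type) [AddCommGroup A₂]
        [Module (PowerSeries ℤ_[p]) A₂] [TopologicalSpace A₂] [DiscreteTopology A₂]
        (ρ₂ : ContinuousRep (Field.absoluteGaloisGroup K) (PowerSeries ℤ_[p]) A₂)
        [TopologicalSpace (PowerSeries (PowerSeries ℤ_[p]))]
        [ContinuousSMul (PowerSeries (PowerSeries ℤ_[p])) (BigRepModule (PowerSeries ℤ_[p]) p A₂)]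
        [Module (PowerSeries ℤ_[p]) (XBig κ ρ₂ 𝔭bar (∅ : Set (HeightOneSpectrum (𝓞 K))))]
        [IsScalarTower (PowerSeries ℤ_[p]) (PowerSeries (PowerSeries ℤ_[p]))
          (XBig κ ρ₂ 𝔭bar (∅ : Set (HeightOneSpectrum (𝓞 K))))],
        ((∀ a : A₂, ∃ n : ℕ, (PowerSeries.X : PowerSeries ℤ_[p]) ^ n • a = 0) ∧
          (∀ a : A₂, ∃ b : A₂, (PowerSeries.X : PowerSeries ℤ_[p]) • b = a) ∧
          (∀ (k : ℕ) (a : A₂), ∃ b : A₂, (PowerSeries.X - PowerSeries.C (x k)) • b = a) ∧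
          (∃ S₀ : Set (HeightOneSpectrum (𝓞 K)), S₀.Finite ∧ GaloisRep.IsUnramifiedOutside S₀ ρ₂) ∧
          (∃ θ₀ : Submodule.torsionBy (PowerSeries ℤ_[p]) A₂ (PowerSeries.X : PowerSeries ℤ_[p]) →+
              PrimaryTorsion (W.baseChange K).geomPoints p,
            (∀ (c : ℤ_[p]) (a : Submodule.torsionBy (PowerSeries ℤ_[p]) A₂ (PowerSeries.X : PowerSeries ℤ_[p])),
                θ₀ (PowerSeries.C c • a) = c • θ₀ a) ∧
            (∀ (σ : Field.absoluteGaloisGroup K)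
                (a : Submodule.torsionBy (PowerSeries ℤ_[p]) A₂ (PowerSeries.X : PowerSeries ℤ_[p])),
                θ₀ (BigGaloisRep.torsionRep ρ₂ (PowerSeries.X : PowerSeries ℤ_[p]) σ a) =
                  (W.baseChange K).primaryTorsionGaloisRep p σ (θ₀ a)) ∧
            Finite θ₀.ker ∧ Finite (PrimaryTorsion (W.baseChange K).geomPoints p ⧸ θ₀.range)) ∧
          (∀ k : ℕ, Function.Surjective (algebraMap ℤ_[p] (padicCoeffIntegers (D k).ι)) ∧
            ∃ θ : Submodule.torsionBy (PowerSeries ℤ_[p]) A₂ (PowerSeries.X - PowerSeries.C (x k)) →+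
                Cofree (D k).Δ.selfDualRep (padicCoeffField (D k).ι),
              (∀ (c : ℤ_[p])
                  (a : Submodule.torsionBy (PowerSeries ℤ_[p]) A₂ (PowerSeries.X - PowerSeries.C (x k))),
                  θ (PowerSeries.C c • a) = algebraMap ℤ_[p] (padicCoeffIntegers (D k).ι) c • θ a) ∧
              (∀ (σ : Field.absoluteGaloisGroup K)
                  (a : Submodule.torsionBy (PowerSeries ℤ_[p]) A₂ (PowerSeries.X - PowerSeries.C (x k))),
                  θ (BigGaloisRep.torsionRep ρ₂ (PowerSeries.X - PowerSeries.C (x k)) σ a) =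
                    (D k).Δ.selfDualCofreeRepOver K σ (θ a)) ∧
              Finite θ.ker ∧ Finite (Cofree (D k).Δ.selfDualRep (padicCoeffField (D k).ι) ⧸ θ.range))) →
        Module.Finite (PowerSeries (PowerSeries ℤ_[p])) (XBig κ ρ₂ 𝔭bar (∅ : Set (HeightOneSpectrum (𝓞 K)))) →
        ∀ k : ℕ,
          ((∀ [TopologicalSpace (PowerSeries (padicCoeffIntegers (D k).ι))]
              [ContinuousSMul (PowerSeries (padicCoeffIntegers (D k).ι))
                (BigRepModule (padicCoeffIntegers (D k).ι) p (Cofree (D k).Δ.selfDualRep (padicCoeffField (D k).ι)))],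
              Module.IsTorsion (PowerSeries (padicCoeffIntegers (D k).ι))
                (XBig κ ((D k).Δ.selfDualCofreeRepOver K) 𝔭bar (∅ : Set (HeightOneSpectrum (𝓞 K))))) →
            ∃ t : PowerSeries ℤ_[p], t ≠ 0 ∧
              ∀ m : QuotSMulTop (PowerSeries.C (PowerSeries.X - PowerSeries.C (x k)))
                (XBig κ ρ₂ 𝔭bar (∅ : Set (HeightOneSpectrum (𝓞 K)))), t • m = 0) ∧
          ∀ (b : padicCoeffIntegers (D k).ι →+* 𝓞_ℂ_[p]),
            (∀ y, ((b y : 𝓞_ℂ_[p]) : ℂ_[p]) =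
              algebraMap (PadicAlgCl p) ℂ_[p] (padicCoeffIntegers.toPadicAlgCl (D k).ι y)) →
          ∀ [TopologicalSpace (PowerSeries (padicCoeffIntegers (D k).ι))]
            [ContinuousSMul (PowerSeries (padicCoeffIntegers (D k).ι))
              (BigRepModule (padicCoeffIntegers (D k).ι) p (Cofree (D k).Δ.selfDualRep (padicCoeffField (D k).ι)))],
            ∃ j : ℕ, Ideal.span {PowerSeries.C ((p : 𝓞_ℂ_[p]) ^ j)} *
                (XBig.charIdeal κ ((D k).Δ.selfDualCofreeRepOver K) 𝔭bar
                  (∅ : Set (HeightOneSpectrum (𝓞 K)))).map (PowerSeries.map b) ≤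
              (Literature.NumberTheory.EllipticCurves.Module.charIdeal (PowerSeries ℤ_[p])
                  (QuotSMulTop (PowerSeries.C (PowerSeries.X - PowerSeries.C (x k)))
                    (XBig κ ρ₂ 𝔭bar (∅ : Set (HeightOneSpectrum (𝓞 K)))))).map
                (PowerSeries.map (R1.toCpInt p)) := by
  sorry

/-! ## §A Two algebra bricks (PROVED): annihilators across the evaluation retraction -/

open scoped Pointwise

/-- **ALG1.** `Λ → B` with a ring retraction `φ : B → Λ` killing `π`; `M` a finite `B`-module. If a non-zero `t ∈ Λ` kills `M/πM`, then some
`s ∈ B` with `π ∤ s` kills `M`. Proof: the homothety `t` maps `M` into `πM`; Cayley–Hamilton with the ideal `(π)` (Matsumura Thm. 2.1, Mathlib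
`LinearMap.exists_monic_and_natDegree_eq_and_coeff_mem_pow_and_aeval_eq_zero`) gives a monic `q` with lower coefficients in `(π)` and
`q(t) M = 0`; `φ(q(t)) = t^{deg q} ≠ 0`, whereas `φ` kills `(π)`. [cite: Matsumura1986, Thm. 2.1] -/
theorem exists_not_dvd_forall_smul_eq_zero {Λ B M : Type*} [CommRing Λ] [IsDomain Λ] [CommRing B] [Algebra Λ B]
    [AddCommGroup M] [Module B M] [Module Λ M] [IsScalarTower Λ B M] [Module.Finite B M]
    (φ : B →+* Λ) (hφ : ∀ t, φ (algebraMap Λ B t) = t) {π : B} (hπ : φ π = 0)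
    {t : Λ} (ht : t ≠ 0) (hkill : ∀ m : QuotSMulTop π M, t • m = 0) :
    ∃ s : B, ¬ (π ∣ s) ∧ ∀ m : M, s • m = 0 := by
  classical
  -- the homothety `algebraMap t` maps `M` into `π M`
  have hrange : LinearMap.range (algebraMap B (Module.End B M) (algebraMap Λ B t)) ≤
      (Ideal.span {π}) • (⊤ : Submodule B M) := by
    rintro _ ⟨m, rfl⟩
    rw [Module.algebraMap_end_apply, Submodule.ideal_span_singleton_smul]
    have h1 : (Submodule.Quotient.mk (p := π • (⊤ : Submodule B M)) (algebraMap Λ B t • m)) = 0 := by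
      have h0 := hkill (Submodule.Quotient.mk m)
      rwa [← Submodule.Quotient.mk_smul, ← IsScalarTower.algebraMap_smul B t m] at h0
    exact (Submodule.Quotient.mk_eq_zero _).mp h1
  obtain ⟨q, hmonic, -, hcoeff, hq⟩ :=
    LinearMap.exists_monic_and_natDegree_eq_and_coeff_mem_pow_and_aeval_eq_zero B
      (algebraMap B (Module.End B M) (algebraMap Λ B t)) (Ideal.span {π}) hrange
  refine ⟨q.eval (algebraMap Λ B t), ?_, fun m => ?_⟩
  · -- `φ (q (t)) = t ^ deg q ≠ 0`, whereas `φ` kills every multiple of `π`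
    have hmapq : q.map φ = Polynomial.X ^ q.natDegree := by
      ext i
      rw [Polynomial.coeff_map, Polynomial.coeff_X_pow]
      rcases lt_trichotomy i q.natDegree with hi | rfl | hi
      · rw [if_neg hi.ne]
        have hmem : q.coeff i ∈ Ideal.span {π} := Ideal.pow_le_self (Nat.sub_ne_zero_of_lt hi) (hcoeff i)
        obtain ⟨r, hr⟩ := Ideal.mem_span_singleton'.mp hmem
        rw [← hr, map_mul, hπ, mul_zero]
      · rw [if_pos rfl, hmonic.coeff_natDegree, map_one]
      · rw [if_neg hi.ne', Polynomial.coeff_eq_zero_of_natDegree_lt hi, map_zero]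
    have hφs : φ (q.eval (algebraMap Λ B t)) = t ^ q.natDegree := by
      rw [← Polynomial.eval₂_hom, ← Polynomial.eval_map, hmapq, Polynomial.eval_pow, Polynomial.eval_X, hφ]
    rintro ⟨r, hr⟩
    have h0 : t ^ q.natDegree = 0 := by rw [← hφs, hr, map_mul, hπ, zero_mul]
    exact pow_ne_zero _ ht h0
  · have h := LinearMap.congr_fun hq m
    rwa [Polynomial.aeval_algebraMap_apply_eq_algebraMap_eval, Module.algebraMap_end_apply,
      LinearMap.zero_apply] at h

/-- **ALG2 (converse of ALG1).** If `ker φ ⊆ (π)` and some `s ∈ B` with `π ∤ s` kills `M`, then `t := φ s ≠ 0` kills `M/πM`. [folklore] -/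
theorem exists_ne_zero_forall_smul_quot_eq_zero {Λ B M : Type*} [CommRing Λ] [CommRing B] [Algebra Λ B]
    [AddCommGroup M] [Module B M] [Module Λ M] [IsScalarTower Λ B M]
    (φ : B →+* Λ) (hφ : ∀ t, φ (algebraMap Λ B t) = t) {π : B} (hker : ∀ b : B, φ b = 0 → π ∣ b)
    {s : B} (hs : ¬ (π ∣ s)) (hkill : ∀ m : M, s • m = 0) :
    ∃ t : Λ, t ≠ 0 ∧ ∀ m : QuotSMulTop π M, t • m = 0 := by
  refine ⟨φ s, fun h0 => hs (hker s h0), fun m => ?_⟩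
  obtain ⟨m, rfl⟩ := Submodule.Quotient.mk_surjective _ m
  rw [← Submodule.Quotient.mk_smul, ← IsScalarTower.algebraMap_smul B (φ s) m, Submodule.Quotient.mk_eq_zero]
  obtain ⟨u, hu⟩ := hker (algebraMap Λ B (φ s) - s) (by rw [map_sub, hφ, sub_self])
  rw [sub_eq_iff_eq_add'.mp hu, add_smul, hkill, zero_add, mul_smul]
  exact Submodule.smul_mem_pointwise_smul _ _ _ Submodule.mem_top

/-! ## §K Kernel (sorry-free) and its converse -/

set_option maxHeartbeats 1600000 in
/-- **Kernel** `N3′ → stub_memberTorsionKY → N3` (SORRY-FREE). The conclusion is the statement of `K2Leaves.stub_memberControl` (tree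
`Cruxes/BSDpOnCellC/Lines/telescopeK2leaves.lean` v1.0, l.310–399) TOKEN FOR TOKEN. Per member `k`: `CellC` unfolds (`two_lt_of_cellC`,
`red_of_cellC`, `mult_of_cellC`), a reading map `b` exists (`exists_ringHom_padicCoeffIntegers_padicComplexInt`), the member package supplies
`ι' ∘ (D k).ι = id`, the parity and a weight-`k` BDP frame; the torsion clause feeds N3′'s transfer, and ALG1 with the evaluation retraction
`φ_k = PowerSeries.map (evAt x_k) : ℤ_p⟦X⟧⟦T⟧ → ℤ_p⟦T⟧` (`evAtMap_map_C`, `evAtMap_pi`; `x_k ∈ 𝔪_{ℤ_p}` as `‖x_k‖ < 1`) turns the non-zero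
`Λ`-annihilator of the fibre into (reg_k). [folklore] -/
theorem memberControl_of_mod
    (hMod : type_of% stub_memberControlMod)
    (hKY : type_of% stub_memberTorsionKY) :
    ∀ (W : WeierstrassCurve ℚ) [W.IsElliptic] [W.IsGloballyMinimal] (p : ℕ) [Fact p.Prime],
    ∀ (N : ℕ) [NeZero N] (K : Type) [Field K] [NumberField K] (Dt : ModularParametrizationData W N)
      (H : HeegnerDatum N (NumberField.discr K)) (ιK : K →+* ℂ) (P : (W.baseChange K).toAffine.Point),
      CellC W p → W.conductorNorm ℤ = N →
      IsImaginaryQuadratic K → NumberField.discr K < -4 → SatisfiesHeegnerHypothesis N K →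
      (W.quadraticTwist (NumberField.discr K : ℚ)).entireLFunction 1 ≠ 0 →
      WeierstrassCurve.Affine.Point.map ιK.toRatAlgHom P = heegnerPointComplex Dt H →
      ¬ (p : ℤ) ∣ Dt.c → ¬ IsOfFinAddOrder P →
      Odd (NumberField.discr K) →
      ∀ (κ : ZpExtension K p), κ.IsAnticyclotomic →
        ∀ (γ : Field.absoluteGaloisGroup K) [Fact (κ.IsTopGenerator γ)]
          (𝔭 : HeightOneSpectrum (𝓞 K)), ((p : ℕ) : 𝓞 K) ∈ 𝔭.asIdeal →
          𝔭.asIdeal.ramificationIdx (𝓞 ℚ) = 1 → 𝔭.asIdeal.inertiaDeg (𝓞 ℚ) = 1 →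
          ∀ (𝔭bar : HeightOneSpectrum (𝓞 K)), ((p : ℕ) : 𝓞 K) ∈ 𝔭bar.asIdeal → 𝔭bar ≠ 𝔭 →
            ((Ideal.span {(p : ℤ)}).primesOver (𝓞 K)).ncard = 2 →
          ∀ (f : CuspForm (CongruenceSubgroup.Gamma0 N) 2), IsNewformOf W f →
            ∀ (ι' : PadicAlgCl p ≃+* ℂ),
              (∀ (w : InfinitePlace K) (k : 𝓞 K),
                k ∈ 𝔭.asIdeal ↔ ‖ι'.symm (w.embedding (k : K))‖ < 1) →
              ∀ (ΩK : ℂ) (Ωp : ℂ_[p]) (Q : PowerSeries 𝓞_ℂ_[p]), ΩK ≠ 0 → ‖Ωp‖ = 1 →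
                R1.IsBDPLFunctionInt p ι' 𝔭 κ γ f ΩK Ωp Q →
      ∀ (L : PowerSeries (PowerSeries (unrIntegers p))) (x : ℕ → ℤ_[p]) (D : ℕ → Skinner2016.HidaCongruentForm W p 1),
        (∀ k, ‖x k‖ < 1) ∧ Filter.Tendsto x Filter.atTop (nhds 0) ∧
        (∃ e : ℕ, PowerSeries.C ((p : 𝓞_ℂ_[p]) ^ e) * Q ∈
          Ideal.span {PowerSeries.map (R1.unrToCpInt p) (PowerSeries.map (PowerSeries.constantCoeff (R := unrIntegers p)) L)}) ∧
        (∀ k : ℕ, (∀ y : coeffField (D k).g, ι' ((D k).ι y) = (y : ℂ)) ∧ 2 * ((p : ℤ) - 1) ∣ (D k).k - 2 ∧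
          ∃ (ΩKg : ℂ) (Ωpg : ℂ_[p]) (Lg : UnrSeries p), ΩKg ≠ 0 ∧ ‖Ωpg‖ = 1 ∧
            IsBDPLFunctionWt ι' 𝔭 κ γ (D k).g ΩKg Ωpg Lg ∧
          ∃ Ψ : UnrSeries p,
            (∃ U : PowerSeries (PowerSeries (unrIntegers p)),
              PowerSeries.map (PowerSeries.C (R := unrIntegers p)) Ψ =
                L + PowerSeries.C (PowerSeries.X - PowerSeries.C (toUnr p (x k))) * U) ∧
            (∃ e : ℕ, PowerSeries.C ((p : 𝓞_ℂ_[p]) ^ e) * PowerSeries.map (R1.unrToCpInt p) Ψ ∈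
              Ideal.span {PowerSeries.map (R1.unrToCpInt p) Lg})) ∧
        (∃ A : ℕ → UnrSeries p, ∀ ℓ : ℕ, ℓ.Prime → ¬ ℓ ∣ N →
          (∃ U : UnrSeries p, A ℓ = PowerSeries.C (toUnr p ((W.frobeniusTrace ℓ : ℤ) : ℤ_[p])) + PowerSeries.X * U) ∧
          ∀ k : ℕ, ∃ (c : unrIntegers p) (U : UnrSeries p),
            A ℓ = PowerSeries.C c + (PowerSeries.X - PowerSeries.C (toUnr p (x k))) * U ∧
            ((c : ℂ_[p]) = algebraMap (PadicAlgCl p) ℂ_[p]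
              ((D k).ι ⟨(UpperHalfPlane.qExpansion 1 ⇑(D k).g).coeff ℓ, coeff_mem_coeffField (D k).g ℓ⟩))) →
      ∀ [TopologicalSpace (PowerSeries ℤ_[p])] (A₂ : Type) [AddCommGroup A₂]
        [Module (PowerSeries ℤ_[p]) A₂] [TopologicalSpace A₂] [DiscreteTopology A₂]
        (ρ₂ : ContinuousRep (Field.absoluteGaloisGroup K) (PowerSeries ℤ_[p]) A₂)
        [TopologicalSpace (PowerSeries (PowerSeries ℤ_[p]))]
        [ContinuousSMul (PowerSeries (PowerSeries ℤ_[p])) (BigRepModule (PowerSeries ℤ_[p]) p A₂)]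
        [Module (PowerSeries ℤ_[p]) (XBig κ ρ₂ 𝔭bar (∅ : Set (HeightOneSpectrum (𝓞 K))))]
        [IsScalarTower (PowerSeries ℤ_[p]) (PowerSeries (PowerSeries ℤ_[p]))
          (XBig κ ρ₂ 𝔭bar (∅ : Set (HeightOneSpectrum (𝓞 K))))],
        ((∀ a : A₂, ∃ n : ℕ, (PowerSeries.X : PowerSeries ℤ_[p]) ^ n • a = 0) ∧
          (∀ a : A₂, ∃ b : A₂, (PowerSeries.X : PowerSeries ℤ_[p]) • b = a) ∧
          (∀ (k : ℕ) (a : A₂), ∃ b : A₂, (PowerSeries.X - PowerSeries.C (x k)) • b = a) ∧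
          (∃ S₀ : Set (HeightOneSpectrum (𝓞 K)), S₀.Finite ∧ GaloisRep.IsUnramifiedOutside S₀ ρ₂) ∧
          (∃ θ₀ : Submodule.torsionBy (PowerSeries ℤ_[p]) A₂ (PowerSeries.X : PowerSeries ℤ_[p]) →+
              PrimaryTorsion (W.baseChange K).geomPoints p,
            (∀ (c : ℤ_[p]) (a : Submodule.torsionBy (PowerSeries ℤ_[p]) A₂ (PowerSeries.X : PowerSeries ℤ_[p])),
                θ₀ (PowerSeries.C c • a) = c • θ₀ a) ∧
            (∀ (σ : Field.absoluteGaloisGroup K)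
                (a : Submodule.torsionBy (PowerSeries ℤ_[p]) A₂ (PowerSeries.X : PowerSeries ℤ_[p])),
                θ₀ (BigGaloisRep.torsionRep ρ₂ (PowerSeries.X : PowerSeries ℤ_[p]) σ a) =
                  (W.baseChange K).primaryTorsionGaloisRep p σ (θ₀ a)) ∧
            Finite θ₀.ker ∧ Finite (PrimaryTorsion (W.baseChange K).geomPoints p ⧸ θ₀.range)) ∧
          (∀ k : ℕ, Function.Surjective (algebraMap ℤ_[p] (padicCoeffIntegers (D k).ι)) ∧
            ∃ θ : Submodule.torsionBy (PowerSeries ℤ_[p]) A₂ (PowerSeries.X - PowerSeries.C (x k)) →+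
                Cofree (D k).Δ.selfDualRep (padicCoeffField (D k).ι),
              (∀ (c : ℤ_[p])
                  (a : Submodule.torsionBy (PowerSeries ℤ_[p]) A₂ (PowerSeries.X - PowerSeries.C (x k))),
                  θ (PowerSeries.C c • a) = algebraMap ℤ_[p] (padicCoeffIntegers (D k).ι) c • θ a) ∧
              (∀ (σ : Field.absoluteGaloisGroup K)
                  (a : Submodule.torsionBy (PowerSeries ℤ_[p]) A₂ (PowerSeries.X - PowerSeries.C (x k))),
                  θ (BigGaloisRep.torsionRep ρ₂ (PowerSeries.X - PowerSeries.C (x k)) σ a) =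
                    (D k).Δ.selfDualCofreeRepOver K σ (θ a)) ∧
              Finite θ.ker ∧ Finite (Cofree (D k).Δ.selfDualRep (padicCoeffField (D k).ι) ⧸ θ.range))) →
        Module.Finite (PowerSeries (PowerSeries ℤ_[p])) (XBig κ ρ₂ 𝔭bar (∅ : Set (HeightOneSpectrum (𝓞 K)))) →
        ∀ k : ℕ,
          (∃ s : PowerSeries (PowerSeries ℤ_[p]),
            ¬ (PowerSeries.C (PowerSeries.X - PowerSeries.C (x k)) ∣ s) ∧
              ∀ m : XBig κ ρ₂ 𝔭bar (∅ : Set (HeightOneSpectrum (𝓞 K))), s • m = 0) ∧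
          ∀ (b : padicCoeffIntegers (D k).ι →+* 𝓞_ℂ_[p]),
            (∀ y, ((b y : 𝓞_ℂ_[p]) : ℂ_[p]) =
              algebraMap (PadicAlgCl p) ℂ_[p] (padicCoeffIntegers.toPadicAlgCl (D k).ι y)) →
          ∀ [TopologicalSpace (PowerSeries (padicCoeffIntegers (D k).ι))]
            [ContinuousSMul (PowerSeries (padicCoeffIntegers (D k).ι))
              (BigRepModule (padicCoeffIntegers (D k).ι) p (Cofree (D k).Δ.selfDualRep (padicCoeffField (D k).ι)))],
            ∃ j : ℕ, Ideal.span {PowerSeries.C ((p : 𝓞_ℂ_[p]) ^ j)} *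
                (XBig.charIdeal κ ((D k).Δ.selfDualCofreeRepOver K) 𝔭bar
                  (∅ : Set (HeightOneSpectrum (𝓞 K)))).map (PowerSeries.map b) ≤
              (Literature.NumberTheory.EllipticCurves.Module.charIdeal (PowerSeries ℤ_[p])
                  (QuotSMulTop (PowerSeries.C (PowerSeries.X - PowerSeries.C (x k)))
                    (XBig κ ρ₂ 𝔭bar (∅ : Set (HeightOneSpectrum (𝓞 K)))))).map
                (PowerSeries.map (R1.toCpInt p)) := by
  intro W _ _ p _ N _ K _ _ Dt H ιK P hC hN hK hdisc hHeeg hL1 hP hc hfin hodd κ hκ γ _ 𝔭 h𝔭 hram hdeg 𝔭bar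
    h𝔭bar hne hsp f hf ι' hι' ΩK Ωp Q hΩK hΩp hQ L x D hpkg _ A₂ _ _ _ _ ρ₂ _ _ _ _ hFD hfg k
  have hM := hMod W p N K Dt H ιK P hC hN hK hdisc hHeeg hL1 hP hc hfin hodd κ hκ γ 𝔭 h𝔭 hram hdeg 𝔭bar
    h𝔭bar hne hsp f hf ι' hι' ΩK Ωp Q hΩK hΩp hQ L x D hpkg A₂ ρ₂ hFD hfg k
  refine ⟨?_, hM.2⟩
  -- the member data at `k`: `ι' ∘ ι_k = id`, parity, a weight-`k` BDP frame; a reading map `b`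
  have hAn := hpkg.2.2.2.1 k
  obtain ⟨ΩKg, Ωpg, Lg, hΩKg, hΩpg, hLg, -⟩ := hAn.2.2
  obtain ⟨b, hb⟩ := exists_ringHom_padicCoeffIntegers_padicComplexInt (D k).ι
  -- KY Thm. 3.0.8 clause (1): the member's big dual Selmer module is `Λ_{𝒪_k}`-torsion (for every admissible topology)
  have htors : ∀ [TopologicalSpace (PowerSeries (padicCoeffIntegers (D k).ι))]
      [ContinuousSMul (PowerSeries (padicCoeffIntegers (D k).ι))
        (BigRepModule (padicCoeffIntegers (D k).ι) p (Cofree (D k).Δ.selfDualRep (padicCoeffField (D k).ι)))],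
      Module.IsTorsion (PowerSeries (padicCoeffIntegers (D k).ι))
        (XBig κ ((D k).Δ.selfDualCofreeRepOver K) 𝔭bar (∅ : Set (HeightOneSpectrum (𝓞 K)))) := by
    intro _ _
    exact hKY W p (MemberInvariantsOfAnacongWt.two_lt_of_cellC hC) (MemberInvariantsOfAnacongWt.red_of_cellC hC)
      (MemberInvariantsOfAnacongWt.mult_of_cellC hC) N K hN hK hdisc hHeeg hodd κ hκ γ 𝔭 h𝔭 hram hdeg 𝔭bar h𝔭bar
      hne hsp ι' hι' (D k) hAn.1 hAn.2.1 b hb ΩKg Ωpg Lg hΩKg hΩpg hLg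
  -- N3′: a non-zero `t ∈ Λ` kills the member fibre `X₂/π_k X₂`
  obtain ⟨t, ht, hkill⟩ := hM.1 @htors
  -- ALG1 across the evaluation retraction `φ_k : ℤ_p⟦X⟧⟦T⟧ → ℤ_p⟦T⟧`, `X ↦ x_k`
  have hxm : x k ∈ IsLocalRing.maximalIdeal ℤ_[p] :=
    (IsLocalRing.mem_maximalIdeal _).mpr (PadicInt.mem_nonunits.mpr (hpkg.1 k))
  exact exists_not_dvd_forall_smul_eq_zero
    (PowerSeries.map (AccumHelpers.evAt (x k) hxm).toRingHom)
    (fun g => TelescopeCarrierAlgOfWitness.evAtMap_map_C (x k) hxm g)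
    (TelescopeCarrierAlgOfWitness.evAtMap_pi (x k) hxm) ht hkill


set_option maxHeartbeats 1600000 in
/-- **Converse** `N3 → N3′` (SORRY-FREE): the reshaped leaf loses nothing — (reg_k)'s `s` gives `t := φ_k s ≠ 0` (the kernel of `φ_k` is
`(π_k)`, `C_dvd_of_evAtMap_eq_zero`) killing the fibre (ALG2); (ctrl_k) is untouched. [folklore] -/
theorem memberControlMod_of_memberControl
    (h3 : type_of% (memberControl_of_mod stub_memberControlMod stub_memberTorsionKY)) :
    type_of% stub_memberControlMod := by
  intro W _ _ p _ N _ K _ _ Dt H ιK P hC hN hK hdisc hHeeg hL1 hP hc hfin hodd κ hκ γ _ 𝔭 h𝔭 hram hdeg 𝔭bar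
    h𝔭bar hne hsp f hf ι' hι' ΩK Ωp Q hΩK hΩp hQ L x D hpkg _ A₂ _ _ _ _ ρ₂ _ _ _ _ hFD hfg k
  have h := h3 W p N K Dt H ιK P hC hN hK hdisc hHeeg hL1 hP hc hfin hodd κ hκ γ 𝔭 h𝔭 hram hdeg 𝔭bar
    h𝔭bar hne hsp f hf ι' hι' ΩK Ωp Q hΩK hΩp hQ L x D hpkg A₂ ρ₂ hFD hfg k
  refine ⟨fun _ => ?_, h.2⟩
  obtain ⟨s, hs, hkill⟩ := h.1
  have hxm : x k ∈ IsLocalRing.maximalIdeal ℤ_[p] :=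
    (IsLocalRing.mem_maximalIdeal _).mpr (PadicInt.mem_nonunits.mpr (hpkg.1 k))
  exact exists_ne_zero_forall_smul_quot_eq_zero
    (PowerSeries.map (AccumHelpers.evAt (x k) hxm).toRingHom)
    (fun g => TelescopeCarrierAlgOfWitness.evAtMap_map_C (x k) hxm g)
    (fun G hG => TelescopeCarrierAlgOfWitness.C_dvd_of_evAtMap_eq_zero (x k) hxm G hG) hs hkill

/-- Certificate: the two stubs compose to the statement of `K2Leaves.stub_memberControl` (N3). -/
example : type_of% (memberControl_of_mod stub_memberControlMod stub_memberTorsionKY) :=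
  memberControl_of_mod stub_memberControlMod stub_memberTorsionKY

end Summit.BirchSwinnertonDyer.BirchSwinnertonDyer.Cruxes.BSDpOnCellC.Telescope.K2Reg
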